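import Summits.HubbardSuperconductivity.HubbardSuperconductivity.Theorems.AnisotropyChordTransferFibre3Fourier
import Summits.HubbardSuperconductivity.HubbardSuperconductivity.Theorems.AnisotropyChordTransferKreinFreeGapK1

/-!
# Route `AnisotropyChord` / H0 rotor rung: PORT N30-A proofs, part 5 — the pole-removed resolvent and the symmetric pole component

Third step of the Krein reduction (memo ROTOR-THEORY-20 §277(a), theory seat `hubbard-h0-rotor-theory-1`, cycle 20): with
`E = ε₁ + T`, `0 < T < 2ε₁`, `L ≥ 4`,
* `Gapply T F c := Σ_{c'} Gentry T c c' · F c'` is the pole-removed resolvent: `Gapply_eq` (Fourier form), the free gap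
  `den_pos` off the poles (from `FreeGap.freeGapK1_holds`), and **`H0E_Gapply`**: `(H₀ − E)(G F) = F − Π_pole F`;
* **`Gapply_H0E`**: `G((H₀ − E)Ψ) = Ψ − Π_pole Ψ`;
* `PiPole` (projection onto the three pole plane waves) and, for a SYMMETRIC `Ψ`, **`PiPole_symm`**: `Π_pole Ψ = β·v` with
  `β = ⟨v, Ψ⟩/(3V²)`, `v = 1 + e^{iK₁·a} + e^{iK₁·b}` («a symmetric charge has equal overlap with the three pole plane waves»);
* `ip_vfun_H0apply`: `⟨v, H₀Ψ⟩ = ε₁⟨v, Ψ⟩`.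
Prover seat `hubbard-h0-rotor-p1` g21; helper for stmt-HubbardSuperconductivity-19089 (`--supports`).
-/

set_option linter.dupNamespace false
set_option autoImplicit false

noncomputable section

open scoped BigOperators
open Complex

namespace Summit.HubbardSuperconductivity.HubbardSuperconductivity.Theorems.AnisotropyChord.Transfer.Fibre3

variable (L : ℕ) [NeZero L]

/-! ## Free energies and the free gap -/

/-- free three-body energy of the pair of momenta `(k₂, k₃)` in the `K₁` fibre. [folklore] -/
def efree (k : Tor L × Tor L) : ℝ := epsT L (K1 L - k.1 - k.2) + epsT L k.1 + epsT L k.2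

omit [NeZero L] in
/-- `den T k₂ k₃ = efree (k₂,k₃) − ε₁ − T`. [folklore] -/
theorem den_eq (T : ℝ) (k : Tor L × Tor L) : den L T k.1 k.2 = efree L k - eps1 L - T := rfl

omit [NeZero L] in
/-- `epsT ≥ 0`. [folklore] -/
theorem epsT_nonneg (k : Tor L) : 0 ≤ epsT L k := by
  unfold epsT
  linarith [Real.cos_le_one (2 * Real.pi * k.1.val / L), Real.cos_le_one (2 * Real.pi * k.2.val / L)]

omit [NeZero L] in
/-- dictionary with the `FreeGap` port: `FreeGap.eps = epsT`. [folklore] -/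
theorem freeGap_eps_eq (k : Tor L) : FreeGap.eps L k = epsT L k := by
  unfold FreeGap.eps FreeGap.eps1D epsT; ring

omit [NeZero L] in
/-- dictionary: `FreeGap.epsMin = eps1`. [folklore] -/
theorem freeGap_epsMin_eq : FreeGap.epsMin L = eps1 L := rfl

omit [NeZero L] in
/-- dictionary: `FreeGap.K1 = K1`. [folklore] -/
theorem freeGap_K1_eq : FreeGap.K1 L = K1 L := rfl

omit [NeZero L] in
/-- non-pole `(k₂,k₃)` means `(K₁ − k₂ − k₃, k₂, k₃)` is not a permutation of the pole. [folklore] -/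
theorem not_isPole_of_not_isPoleK1 {k : Tor L × Tor L} (hk : IsPoleK1 L k.1 k.2 = false) :
    ¬ FreeGap.IsPole L (K1 L - k.1 - k.2) k.1 k.2 := by
  unfold FreeGap.IsPole
  unfold IsPoleK1 at hk
  rw [freeGap_K1_eq]
  simp only [Bool.or_eq_false_iff, Bool.and_eq_false_iff, decide_eq_false_iff_not] at hk
  obtain ⟨⟨h00, hK0⟩, h0K⟩ := hk
  rintro (⟨_, h2, h3⟩ | ⟨_, h2, h3⟩ | ⟨_, h2, h3⟩)
  · exact (h00.resolve_left (fun h => h h2)) h3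
  · exact (hK0.resolve_left (fun h => h h2)) h3
  · exact (h0K.resolve_left (fun h => h h2)) h3

/-- **free gap:** off the poles `efree ≥ 3ε₁` (`L ≥ 4`). [folklore] -/
theorem efree_ge (hL : 4 ≤ L) {k : Tor L × Tor L} (hk : IsPoleK1 L k.1 k.2 = false) : 3 * eps1 L ≤ efree L k := by
  have h := FreeGap.freeGapK1_holds L hL (K1 L - k.1 - k.2) k.1 k.2 (by rw [freeGap_K1_eq]; abel)
    (not_isPole_of_not_isPoleK1 L hk)
  rw [freeGap_epsMin_eq, freeGap_eps_eq, freeGap_eps_eq, freeGap_eps_eq] at h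
  exact h

/-- `den > 0` off the poles for `T < 2ε₁`. [folklore] -/
theorem den_pos (hL : 4 ≤ L) {T : ℝ} (hT : T < 2 * eps1 L) {k : Tor L × Tor L} (hk : IsPoleK1 L k.1 k.2 = false) :
    0 < den L T k.1 k.2 := by
  rw [den_eq]; have := efree_ge L hL hk; linarith

/-! ## Linearity of `H₀` -/

omit [NeZero L] in
/-- `H₀` of a finite linear combination. [folklore] -/
theorem H0apply_sum_smul {ι : Type*} (s : Finset ι) (K : Tor L) (a : ι → ℂ) (g : ι → Cfg L → ℂ) (c : Cfg L) :
    H0apply L K (fun d => ∑ i ∈ s, a i * g i d) c = ∑ i ∈ s, a i * H0apply L K (g i) c := by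
  classical
  induction s using Finset.induction_on with
  | empty => simp [H0apply_four, hopT]
  | insert i s hi ih =>
    simp only [Finset.sum_insert hi]
    have hadd : H0apply L K (fun d => a i * g i d + ∑ j ∈ s, a j * g j d) c
        = H0apply L K (fun d => a i * g i d) c + H0apply L K (fun d => ∑ j ∈ s, a j * g j d) c := by
      simp only [H0apply_four, hopT]; ring
    have hsm : H0apply L K (fun d => a i * g i d) c = a i * H0apply L K (g i) c := by
      simp only [H0apply_four, hopT]; ring
    rw [hadd, hsm, ih]

/-! ## The pole-removed resolvent -/

/-- the action of the pole-removed free resolvent kernel on a function. [folklore] -/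
def Gapply (T : ℝ) (F : Cfg L → ℂ) : Cfg L → ℂ := fun c => ∑ c' : Cfg L, Gentry L T c c' * F c'

/-- Fourier coefficient of the resolvent: `0` on the poles, `⟨pw_k, F⟩/den_k` otherwise. [folklore] -/
def gcoef (T : ℝ) (F : Cfg L → ℂ) (k : Tor L × Tor L) : ℂ :=
  if IsPoleK1 L k.1 k.2 then 0 else ip L (pw L k.1 k.2) F / (den L T k.1 k.2 : ℂ)

/-- the kernel in Fourier form. [folklore] -/
theorem Gentry_eq (T : ℝ) (c c' : Cfg L) :
    Gentry L T c c' = (1 / ((L : ℂ) ^ 2) ^ 2) * ∑ k : Tor L × Tor L,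
      (if IsPoleK1 L k.1 k.2 then 0 else pw L k.1 k.2 c * (starRingEnd ℂ) (pw L k.1 k.2 c') / (den L T k.1 k.2 : ℂ)) := by
  unfold Gentry
  congr 1
  conv_rhs => rw [Fintype.sum_prod_type]
  refine Finset.sum_congr rfl fun k₂ _ => Finset.sum_congr rfl fun k₃ _ => ?_
  by_cases hk : IsPoleK1 L k₂ k₃ = true
  · simp only [hk, if_true]
  · simp only [hk]
    rw [pw_mul_conj_pw L (k₂, k₃) c c']

/-- **`G F` in Fourier form:** `G F = V⁻² Σ_k gcoef_k · pw_k`. [folklore] -/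
theorem Gapply_eq (T : ℝ) (F : Cfg L → ℂ) (c : Cfg L) :
    Gapply L T F c = (1 / ((L : ℂ) ^ 2) ^ 2) * ∑ k : Tor L × Tor L, gcoef L T F k * pw L k.1 k.2 c := by
  unfold Gapply gcoef
  simp_rw [Gentry_eq, mul_assoc, ← Finset.mul_sum]
  congr 1
  simp_rw [Finset.sum_mul]
  rw [Finset.sum_comm]
  refine Finset.sum_congr rfl fun k _ => ?_
  split_ifs with hk
  · simp
  · unfold ip
    rw [Finset.sum_div, Finset.sum_mul]
    refine Finset.sum_congr rfl fun c' _ => ?_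
    ring

/-- `⟨pw_k, H₀ F⟩ = e_k ⟨pw_k, F⟩` (Hermiticity + plane-wave eigenvalue). [folklore] -/
theorem ip_pw_H0apply (k : Tor L × Tor L) (F : Cfg L → ℂ) :
    ip L (pw L k.1 k.2) (H0apply L (K1 L) F) = (efree L k : ℂ) * ip L (pw L k.1 k.2) F := by
  rw [ip_H0apply_symm]
  have : H0apply L (K1 L) (pw L k.1 k.2) = fun c => (efree L k : ℂ) * pw L k.1 k.2 c := by
    funext c; rw [H0apply_pw]; rfl
  rw [this]
  have h2 : ip L F (fun c => (efree L k : ℂ) * pw L k.1 k.2 c) = (efree L k : ℂ) * ip L F (pw L k.1 k.2) := by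
    unfold ip; rw [Finset.mul_sum]; refine Finset.sum_congr rfl fun c _ => ?_; ring
  rw [h2, map_mul, Complex.conj_ofReal, conj_ip]

/-- the projection onto the three pole plane waves. [folklore] -/
def PiPole (F : Cfg L → ℂ) : Cfg L → ℂ := fun c =>
  (1 / ((L : ℂ) ^ 2) ^ 2) * ∑ k : Tor L × Tor L, (if IsPoleK1 L k.1 k.2 then ip L (pw L k.1 k.2) F * pw L k.1 k.2 c else 0)

/-- completeness in the form `V⁻² Σ_k ⟨pw_k, F⟩ pw_k = F`. [folklore] -/
theorem fourier_inversion (F : Cfg L → ℂ) (c : Cfg L) :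
    (1 / ((L : ℂ) ^ 2) ^ 2) * ∑ k : Tor L × Tor L, ip L (pw L k.1 k.2) F * pw L k.1 k.2 c = F c := by
  have hV : ((L : ℂ) ^ 2) ^ 2 ≠ 0 := by
    have : (L : ℂ) ≠ 0 := by exact_mod_cast (NeZero.ne L)
    positivity
  unfold ip
  simp_rw [Finset.sum_mul]
  rw [Finset.sum_comm]
  have : ∀ c' : Cfg L, ∑ k : Tor L × Tor L, (starRingEnd ℂ) (pw L k.1 k.2 c') * F c' * pw L k.1 k.2 c
      = F c' * (if c = c' then ((L : ℂ) ^ 2) ^ 2 else 0) := by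
    intro c'
    rw [← sum_pw_mul_conj_pw L c c', Finset.mul_sum]
    refine Finset.sum_congr rfl fun k _ => ?_; ring
  simp_rw [this]
  simp only [mul_ite, mul_zero, Finset.sum_ite_eq, Finset.mem_univ, if_true]
  have hL : (L : ℂ) ≠ 0 := by exact_mod_cast (NeZero.ne L)
  field_simp

/-- **`(H₀ − E)·G = 1 − Π_pole`** (with `E = ε₁ + T`, `T < 2ε₁`, `L ≥ 4`). [folklore] -/
theorem H0E_Gapply (hL : 4 ≤ L) {T : ℝ} (hT : T < 2 * eps1 L) (F : Cfg L → ℂ) (c : Cfg L) :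
    H0apply L (K1 L) (Gapply L T F) c - ((eps1 L + T : ℝ) : ℂ) * Gapply L T F c = F c - PiPole L F c := by
  have hG : Gapply L T F = fun d => ∑ k : Tor L × Tor L,
      ((1 / ((L : ℂ) ^ 2) ^ 2) * gcoef L T F k) * pw L k.1 k.2 d := by
    funext d; rw [Gapply_eq, Finset.mul_sum]; refine Finset.sum_congr rfl fun k _ => ?_; ring
  rw [hG, H0apply_sum_smul]
  simp_rw [H0apply_pw]
  rw [Finset.mul_sum, ← Finset.sum_sub_distrib]
  -- termwise: (e_k − E)·gcoef_k = [non-pole] ⟨pw_k, F⟩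
  have hterm : ∀ k : Tor L × Tor L,
      (1 / ((L : ℂ) ^ 2) ^ 2) * gcoef L T F k * (((epsT L (K1 L - k.1 - k.2) + epsT L k.1 + epsT L k.2 : ℝ) : ℂ) * pw L k.1 k.2 c)
        - ((eps1 L + T : ℝ) : ℂ) * ((1 / ((L : ℂ) ^ 2) ^ 2) * gcoef L T F k * pw L k.1 k.2 c)
      = (1 / ((L : ℂ) ^ 2) ^ 2) * (ip L (pw L k.1 k.2) F * pw L k.1 k.2 c)
        - (1 / ((L : ℂ) ^ 2) ^ 2) * (if IsPoleK1 L k.1 k.2 then ip L (pw L k.1 k.2) F * pw L k.1 k.2 c else 0) := by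
    intro k
    unfold gcoef
    by_cases hk : IsPoleK1 L k.1 k.2 = true
    · simp [hk]
    · have hk' : IsPoleK1 L k.1 k.2 = false := by simpa using hk
      have hden : (den L T k.1 k.2 : ℂ) ≠ 0 := by
        exact_mod_cast (den_pos L hL hT hk').ne'
      simp only [hk', Bool.false_eq_true, if_false, mul_zero, sub_zero]
      have e : (((epsT L (K1 L - k.1 - k.2) + epsT L k.1 + epsT L k.2 : ℝ) : ℂ)) - ((eps1 L + T : ℝ) : ℂ)
          = (den L T k.1 k.2 : ℂ) := by
        unfold den; push_cast; ring
      calc (1 / ((L : ℂ) ^ 2) ^ 2) * (ip L (pw L k.1 k.2) F / (den L T k.1 k.2 : ℂ))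
              * (((epsT L (K1 L - k.1 - k.2) + epsT L k.1 + epsT L k.2 : ℝ) : ℂ) * pw L k.1 k.2 c)
            - ((eps1 L + T : ℝ) : ℂ) * ((1 / ((L : ℂ) ^ 2) ^ 2) * (ip L (pw L k.1 k.2) F / (den L T k.1 k.2 : ℂ)) * pw L k.1 k.2 c)
          = (1 / ((L : ℂ) ^ 2) ^ 2) * (ip L (pw L k.1 k.2) F / (den L T k.1 k.2 : ℂ)) * pw L k.1 k.2 c
              * ((((epsT L (K1 L - k.1 - k.2) + epsT L k.1 + epsT L k.2 : ℝ) : ℂ)) - ((eps1 L + T : ℝ) : ℂ)) := by ring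
        _ = (1 / ((L : ℂ) ^ 2) ^ 2) * (ip L (pw L k.1 k.2) F * pw L k.1 k.2 c) := by
            rw [e]; field_simp
  simp_rw [hterm]
  rw [Finset.sum_sub_distrib, ← Finset.mul_sum, ← Finset.mul_sum, fourier_inversion]
  rfl

/-- **`G·(H₀ − E) = 1 − Π_pole`**: `G((H₀ − E)Ψ) = Ψ − Π_pole Ψ`. [folklore] -/
theorem Gapply_H0E (hL : 4 ≤ L) {T : ℝ} (hT : T < 2 * eps1 L) (Ψ : Cfg L → ℂ) (c : Cfg L) :
    Gapply L T (fun d => H0apply L (K1 L) Ψ d - ((eps1 L + T : ℝ) : ℂ) * Ψ d) c = Ψ c - PiPole L Ψ c := by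
  rw [Gapply_eq]
  have hterm : ∀ k : Tor L × Tor L,
      gcoef L T (fun d => H0apply L (K1 L) Ψ d - ((eps1 L + T : ℝ) : ℂ) * Ψ d) k * pw L k.1 k.2 c
        = ip L (pw L k.1 k.2) Ψ * pw L k.1 k.2 c
          - (if IsPoleK1 L k.1 k.2 then ip L (pw L k.1 k.2) Ψ * pw L k.1 k.2 c else 0) := by
    intro k
    unfold gcoef
    by_cases hk : IsPoleK1 L k.1 k.2 = true
    · simp [hk]
    · have hk' : IsPoleK1 L k.1 k.2 = false := by simpa using hk
      have hden : (den L T k.1 k.2 : ℂ) ≠ 0 := by exact_mod_cast (den_pos L hL hT hk').ne'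
      simp only [hk', Bool.false_eq_true, if_false, sub_zero]
      have hip : ip L (pw L k.1 k.2) (fun d => H0apply L (K1 L) Ψ d - ((eps1 L + T : ℝ) : ℂ) * Ψ d)
          = (den L T k.1 k.2 : ℂ) * ip L (pw L k.1 k.2) Ψ := by
        have h1 : ip L (pw L k.1 k.2) (fun d => H0apply L (K1 L) Ψ d - ((eps1 L + T : ℝ) : ℂ) * Ψ d)
            = ip L (pw L k.1 k.2) (H0apply L (K1 L) Ψ) - ((eps1 L + T : ℝ) : ℂ) * ip L (pw L k.1 k.2) Ψ := by
          unfold ip; rw [Finset.mul_sum, ← Finset.sum_sub_distrib]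
          refine Finset.sum_congr rfl fun d _ => ?_; ring
        rw [h1, ip_pw_H0apply]
        unfold den efree; push_cast; ring
      rw [hip]; field_simp
  simp_rw [hterm]
  rw [Finset.sum_sub_distrib, mul_sub, fourier_inversion]
  rfl

/-! ## The symmetric pole component -/

/-- the free symmetric pole state as a function on the fibre: `v(a,b) = 1 + e^{iK₁·a} + e^{iK₁·b}`. [folklore] -/
def vfun : Cfg L → ℂ := fun c => 1 + phase L (K1 L) c.1 + phase L (K1 L) c.2

/-- `phase 0 r = 1`. [folklore] -/
theorem phase_zero_left (r : Tor L) : phase L 0 r = 1 := by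
  rw [phase_comm]; exact phase_zero L r

/-- the three pole plane waves. [folklore] -/
theorem pw_pole₀ (c : Cfg L) : pw L 0 0 c = 1 := by unfold pw; rw [phase_zero_left, phase_zero_left, mul_one]

/-- [folklore] -/
theorem pw_pole₁ (c : Cfg L) : pw L (K1 L) 0 c = phase L (K1 L) c.1 := by unfold pw; rw [phase_zero_left, mul_one]

/-- [folklore] -/
theorem pw_pole₂ (c : Cfg L) : pw L 0 (K1 L) c = phase L (K1 L) c.2 := by unfold pw; rw [phase_zero_left, one_mul]

omit [NeZero L] in
/-- `K₁ ≠ 0` for `L ≥ 2`. [folklore] -/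
theorem K1_ne_zero (hL : 2 ≤ L) : K1 L ≠ 0 := by
  intro h
  have h1 : ((1 : ZMod L)) = 0 := congrArg Prod.fst h
  have : Fact (1 < L) := ⟨by omega⟩
  have := ZMod.val_one L
  rw [h1, ZMod.val_zero] at this
  exact absurd this (by norm_num)

omit [NeZero L] in
/-- the pole indicator as membership in the explicit three-element set. [folklore] -/
theorem isPoleK1_iff (k : Tor L × Tor L) :
    IsPoleK1 L k.1 k.2 = true ↔ k = (0, 0) ∨ k = (K1 L, 0) ∨ k = (0, K1 L) := by
  unfold IsPoleK1
  simp only [Bool.or_eq_true, Bool.and_eq_true, decide_eq_true_eq]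
  constructor
  · rintro ((⟨h1, h2⟩ | ⟨h1, h2⟩) | ⟨h1, h2⟩)
    · exact Or.inl (Prod.ext h1 h2)
    · exact Or.inr (Or.inl (Prod.ext h1 h2))
    · exact Or.inr (Or.inr (Prod.ext h1 h2))
  · rintro (h | h | h) <;> rw [h]
    · exact Or.inl (Or.inl ⟨rfl, rfl⟩)
    · exact Or.inl (Or.inr ⟨rfl, rfl⟩)
    · exact Or.inr ⟨rfl, rfl⟩

/-- the pole sum written out (`L ≥ 2`, so the three poles are distinct). [folklore] -/
theorem sum_pole (hL : 2 ≤ L) (g : Tor L × Tor L → ℂ) :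
    ∑ k : Tor L × Tor L, (if IsPoleK1 L k.1 k.2 then g k else 0) = g (0, 0) + g (K1 L, 0) + g (0, K1 L) := by
  classical
  have hK := K1_ne_zero L hL
  rw [← Finset.sum_filter]
  have hset : Finset.univ.filter (fun k : Tor L × Tor L => IsPoleK1 L k.1 k.2 = true)
      = {(0, 0), (K1 L, 0), (0, K1 L)} := by
    ext k
    simp only [Finset.mem_filter, Finset.mem_univ, true_and, isPoleK1_iff, Finset.mem_insert, Finset.mem_singleton]
  have n2 : (K1 L, (0 : Tor L)) ∉ ({((0 : Tor L), K1 L)} : Finset (Tor L × Tor L)) := by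
    simp only [Finset.mem_singleton, Prod.mk.injEq, not_and]
    intro h; exact absurd h hK
  have n1 : ((0 : Tor L), (0 : Tor L)) ∉ ({(K1 L, (0 : Tor L)), ((0 : Tor L), K1 L)} : Finset (Tor L × Tor L)) := by
    simp only [Finset.mem_insert, Finset.mem_singleton, Prod.mk.injEq, not_or, not_and]
    exact ⟨fun h => absurd h.symm hK, fun _ h => hK h.symm⟩
  rw [hset, Finset.sum_insert n1, Finset.sum_insert n2, Finset.sum_singleton]
  ring

/-- `Π_pole F = V⁻²(⟨1,F⟩·1 + ⟨e^{iK₁a},F⟩ e^{iK₁a} + ⟨e^{iK₁b},F⟩ e^{iK₁b})`. [folklore] -/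
theorem PiPole_eq (hL : 2 ≤ L) (F : Cfg L → ℂ) (c : Cfg L) :
    PiPole L F c = (1 / ((L : ℂ) ^ 2) ^ 2) *
      (ip L (pw L 0 0) F + ip L (pw L (K1 L) 0) F * phase L (K1 L) c.1 + ip L (pw L 0 (K1 L)) F * phase L (K1 L) c.2) := by
  unfold PiPole
  rw [sum_pole L hL]
  simp only [pw_pole₀, pw_pole₁, pw_pole₂, mul_one]

/-- the involution `(a, b) ↦ (−a, b − a)` of the fibre (relabelling `1 ↔ 2`). [folklore] -/
def u12Map : Cfg L → Cfg L := fun c => (-c.1, c.2 - c.1)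

omit [NeZero L] in
/-- `u12Map` is an involution. [folklore] -/
theorem u12Map_involutive : Function.Involutive (u12Map L) := by
  intro c; unfold u12Map; ext <;> simp

/-- **equal overlaps:** for symmetric `Ψ`, `⟨1, Ψ⟩ = ⟨e^{iK₁·a}, Ψ⟩ = ⟨e^{iK₁·b}, Ψ⟩`. [folklore] -/
theorem overlaps_eq {Ψ : Cfg L → ℂ} (hΨ : IsSymm L (K1 L) Ψ) :
    ip L (pw L 0 0) Ψ = ip L (pw L (K1 L) 0) Ψ ∧ ip L (pw L 0 (K1 L)) Ψ = ip L (pw L (K1 L) 0) Ψ := by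
  obtain ⟨h1, h2⟩ := hΨ
  constructor
  · -- use Ψ(a,b) = e^{iK₁a} Ψ(−a, b−a) and reindex by the involution
    unfold ip
    simp only [pw_pole₀, pw_pole₁, map_one, one_mul]
    calc ∑ c : Cfg L, Ψ c = ∑ c : Cfg L, phase L (K1 L) c.1 * Ψ (u12Map L c) := by
          refine Finset.sum_congr rfl fun c _ => ?_; unfold u12Map; rw [h2 c]
      _ = ∑ c : Cfg L, phase L (K1 L) (u12Map L c).1 * Ψ (u12Map L (u12Map L c)) := by
          rw [← Equiv.sum_comp (u12Map_involutive L).toPerm]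
          rfl
      _ = ∑ c : Cfg L, (starRingEnd ℂ) (phase L (K1 L) c.1) * Ψ c := by
          refine Finset.sum_congr rfl fun c _ => ?_
          rw [u12Map_involutive L c, conj_phase]; rfl
  · unfold ip
    simp only [pw_pole₁, pw_pole₂]
    rw [← Equiv.sum_comp (Equiv.prodComm (Tor L) (Tor L))]
    refine Finset.sum_congr rfl fun c _ => ?_
    simp only [Equiv.prodComm_apply, Prod.snd_swap]
    rw [show Ψ c.swap = Ψ (c.2, c.1) from rfl, h1 c]

/-- `⟨v, Ψ⟩ = 3⟨e^{iK₁·a}, Ψ⟩` for symmetric `Ψ`. [folklore] -/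
theorem ip_vfun_eq {Ψ : Cfg L → ℂ} (hΨ : IsSymm L (K1 L) Ψ) :
    ip L (vfun L) Ψ = 3 * ip L (pw L (K1 L) 0) Ψ := by
  obtain ⟨h0, h2⟩ := overlaps_eq L hΨ
  have : ip L (vfun L) Ψ = ip L (pw L 0 0) Ψ + ip L (pw L (K1 L) 0) Ψ + ip L (pw L 0 (K1 L)) Ψ := by
    unfold ip vfun
    rw [← Finset.sum_add_distrib, ← Finset.sum_add_distrib]
    refine Finset.sum_congr rfl fun c _ => ?_
    rw [pw_pole₀, pw_pole₁, pw_pole₂, map_add, map_add]; ring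
  rw [this, h0, h2]; ring

/-- **symmetric pole component:** `Π_pole Ψ = (⟨v,Ψ⟩/(3V²))·v` for symmetric `Ψ` (`L ≥ 2`). [folklore] -/
theorem PiPole_symm (hL : 2 ≤ L) {Ψ : Cfg L → ℂ} (hΨ : IsSymm L (K1 L) Ψ) (c : Cfg L) :
    PiPole L Ψ c = (ip L (vfun L) Ψ / (3 * ((L : ℂ) ^ 2) ^ 2)) * vfun L c := by
  obtain ⟨h0, h2⟩ := overlaps_eq L hΨ
  rw [PiPole_eq L hL, h0, h2, ip_vfun_eq L hΨ]
  unfold vfun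
  have hV : ((L : ℂ) ^ 2) ^ 2 ≠ 0 := by
    have : (L : ℂ) ≠ 0 := by exact_mod_cast (NeZero.ne L)
    positivity
  field_simp

omit [NeZero L] in
/-- the poles have free energy `ε₁`: `efree = ε₁` at the three pole pairs (`L ≥ 2`). [folklore] -/
theorem efree_pole (hL : 2 ≤ L) :
    efree L (0, 0) = eps1 L ∧ efree L (K1 L, 0) = eps1 L ∧ efree L (0, K1 L) = eps1 L := by
  have : Fact (1 < L) := ⟨by omega⟩
  have hK : epsT L (K1 L) = eps1 L := by
    unfold epsT eps1 K1
    simp only [ZMod.val_one, ZMod.val_zero, Nat.cast_one, Nat.cast_zero, mul_zero, zero_div, Real.cos_zero, mul_one]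
    ring
  have h0 : epsT L 0 = 0 := by
    unfold epsT; simp only [Prod.fst_zero, Prod.snd_zero, ZMod.val_zero, Nat.cast_zero, mul_zero, zero_div,
      Real.cos_zero]; ring
  refine ⟨?_, ?_, ?_⟩ <;> simp only [efree, sub_zero, sub_self, h0, hK, zero_add, add_zero]

/-- **`⟨v, H₀Ψ⟩ = ε₁⟨v, Ψ⟩`** (`v` is a free eigenvector with energy `ε₁`). [folklore] -/
theorem ip_vfun_H0apply (hL : 2 ≤ L) (Ψ : Cfg L → ℂ) :
    ip L (vfun L) (H0apply L (K1 L) Ψ) = (eps1 L : ℂ) * ip L (vfun L) Ψ := by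
  obtain ⟨e0, e1, e2⟩ := efree_pole L hL
  have hsplit : ∀ G : Cfg L → ℂ,
      ip L (vfun L) G = ip L (pw L 0 0) G + ip L (pw L (K1 L) 0) G + ip L (pw L 0 (K1 L)) G := by
    intro G
    unfold ip vfun
    rw [← Finset.sum_add_distrib, ← Finset.sum_add_distrib]
    refine Finset.sum_congr rfl fun c _ => ?_
    rw [pw_pole₀, pw_pole₁, pw_pole₂, map_add, map_add]; ring
  rw [hsplit, hsplit Ψ]
  have a0 := ip_pw_H0apply L ((0 : Tor L), (0 : Tor L)) Ψ
  have a1 := ip_pw_H0apply L (K1 L, (0 : Tor L)) Ψ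
  have a2 := ip_pw_H0apply L ((0 : Tor L), K1 L) Ψ
  simp only at a0 a1 a2
  rw [a0, a1, a2, e0, e1, e2]; ring

end Summit.HubbardSuperconductivity.HubbardSuperconductivity.Theorems.AnisotropyChord.Transfer.Fibre3

end
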